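import Summits.BirchSwinnertonDyer.BirchSwinnertonDyer.Theorems.AlignedTransportAtTwoMainConjectureOfRankZeroBSDAtTwoCubicCapitulationDoor
import Literature.NumberTheory.IwasawaTheory.CyclotomicTwoLayerTwoNonNormUnit
import HarnessLib

/-!
# Route `AlignedTransportAtTwo`, crux C2 `MainConjectureOfRankZeroBSDAtTwo` (stmt-BirchSwinnertonDyer-22298):
# THE PRO-CYCLIC DOOR INTO `MC₂(W)` — on the sub-cell `Δ_min ≡ 5 (mod 8)`, `h(ℚ(β))` odd: if the fundamental unit has `2`-adic depth `t ≤ 3` at the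
# degree-one dyadic prime (`ε ≢ ±1 (mod 𝔭₁⁴)`) and `4 ∣ h(ℚ(β,√2))`, then `rank₂ Cl(K_m) ≤ 1` for every layer, `μ₂ = 0`, `λ₂ ≤ 1`, and `MC₂(W)`

HONEST FRAMING (cell `bsd-f1-sign2`, WIDTH-5 attached prover seat `bsd-line-att-p3` gen 46 on line `birth` of the lead `bsd-line-att-p2`;
`--supports` stmt-BirchSwinnertonDyer-22298, closes nothing; BSD is NOT proved by any of this; the crux C2, its verdict «blocked-on
`Rank1Residual.GreenbergMuConjectureIrreducible`» and every registered stub are untouched).  THEOREMS ONLY — no definition, no named fact, no `sorry`.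
The `W`-level packaging of this seat's Literature doors `IwasawaTheory/ClassGroupPRankLeOneOfCardFixedLeTwoLayerTwo` (the pro-cyclic door on the class
group: `2 ∤ h_K`, `2 ≤ ord₂ h(K_1)`, `4 ∤ #Cl(K_2)^{Gal(K_2/K)}` ⟹ `rank₂ Cl(K_2) ≤ 1`), `…/ClassGroupPRankLeOneOfNonNormUnitLayerTwo` (Chevalley's currency: one unit
of `K` outside `N_{K_2/K}K_2ˣ`) and `…/CyclotomicTwoLayerTwoNonNormUnit` (the unit hypothesis from the congruence `ε ≢ ±1 (mod 𝔭₁⁴)` via att-p3 g43's norm form),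
companion of att-p3 g42/g43's `…CubicDepthDoor{,GenusCert}` (`t ≥ 4`, `e₁ ≤ 1`), g44/g45's `…CubicLayerTwo{UnitDoorFlex,RowN9139}` and g45's `…CubicCapitulationDoor`.

WHY.  In `Λ`-terms (`X = Λ/J` cyclic as `h(ℚ(β))` is odd; `#X/TX = 2^{t−2}`, `A_1 = ℤ₂/J(−2)`): `t = 3` and `e₁ ≥ 2` force `J ∋ T − a` with `v₂(a) = 1`, so `X` is a
quotient of `Λ/(T − a) ≅ ℤ₂` — PRO-CYCLIC, `μ₂ = 0`, `λ₂ ≤ 1` (`λ₂ = 1` exactly when `X ≅ ℤ₂`).  This is the one remaining kit-free lever on the class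
«`t = 3 ∧ e₁ ≥ 2`» of the cell's census (customer `N = 12163`: att-p3 g45 §4, `e₁ = 2`, dead at layer `2`), where the depth door (`t ≥ 4`), Chevalley (`t = 2`), the
layer-one/two unit doors and the capitulation door are all silent.

* **`classGroupPRank_le_one_adjoin_of_two_le_of_not_mem_pow_four`** — `W` globally minimal, good ordinary at `2`, no rational `2`-torsion abscissa,
  `Δ_min ≡ 5 (mod 8)`, `β` a root of the `2`-division cubic; displayed: `h(ℚ(β))` odd, `2 ∤ d_{ℚ(β)}`, `𝔭₁` of norm `2`, a unit `ε` with `ε − 1 ∉ 𝔭₁⁴` and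
  `ε + 1 ∉ 𝔭₁⁴`, and for the cyclotomic `ℤ₂`-extension `κ` of `ℚ(β)`: **`2 ≤ ord₂ h(K_1)`** ⟹ `rank₂ Cl(K_m) ≤ 1` for every `m`, `μ₂(κ) = 0`, `λ₂(κ) ≤ 1`.
* **`mazurMainConjecture_two_of_muIneqRel_of_two_le_of_not_mem_pow_four`** — PRINT⁵ + MuIneqʳ (registered stub verbatim) + the cell hypotheses + `Δ_W < 0` + the same
  data (with `2 ≤ ord₂ h(K_1)` for every cyclotomic `κ`) ⟹ `MC₂(W)` (att-p5 g24's cubic carrier road).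

CONDITIONAL theorems (PRINT⁵, MuIneqʳ, and the class-number bit `2 ≤ ord₂ h(ℚ(β,√2))` displayed — the latter is a LOWER bound on a class group of the sextic
first layer, not kernelised for any seed); nothing is asserted about any curve; nothing is closed; BSD is not proved.

References: [Washington1997] §13.3 Prop. 13.22–13.23; [Lang1990] Ch. 13 §4 Lemma 4.1; [Fukuda1994] Thm. 1 (2); [NeukirchANT1999] Ch. III (1.6)(iv), Ch. V §1;
[Omeara1963] §63B; [Kato2004Asterisque] Thm. 17.4 (1)(2) (p. 273); [GreenbergLNM1716] Thm. 4.1 (p. 102), Conj. 1.11 (p. 58); tree: this seat's three Literature files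
above, att-p5 g24 `…CubicCarrierRoad`, att-p3 g45 `…CubicCapitulationDoor` (template).
-/

set_option linter.dupNamespace false
set_option autoImplicit false

noncomputable section

open scoped Classical NumberField nonZeroDivisors

namespace Summit.BirchSwinnertonDyer.BirchSwinnertonDyer.Theorems.AlignedTransportAtTwoCubicProCyclicDoor

open NumberField IsDedekindDomain Polynomial WeierstrassCurve IntermediateField CongruenceSubgroup
  Literature.NumberTheory.IwasawaTheory Literature.NumberTheory.GaloisRepresentations
  Literature.NumberTheory.GaloisRepresentations.Herbrand Literature.NumberTheory.GaloisRepresentations.MinkowskiUnit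
  Literature.NumberTheory.GaloisRepresentations.CyclicNormIndex
  Literature.NumberTheory.EllipticCurves Literature.NumberTheory.EllipticCurves.Greenberg1999
  Literature.NumberTheory.EllipticCurves.ModularForms
  Literature.NumberTheory.EllipticCurves.Rank1Residual
  Literature.NumberTheory.EllipticCurves.Module
  Literature.NumberTheory.NumberFields Literature.NumberTheory.NumberFields.AmbiguousClass
  Summit.BirchSwinnertonDyer.Rank1Residual
  Summit.BirchSwinnertonDyer.Rank1Residual.X1.MuLambda
  Summit.BirchSwinnertonDyer.Rank1Residual.X5
  Summit.BirchSwinnertonDyer.Rank1Residual.F1Sign2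
  Summit.BirchSwinnertonDyer.BirchSwinnertonDyer.Theorems.Rank1ResidualX1Defs
  Summit.BirchSwinnertonDyer.BirchSwinnertonDyer.Theses.AlignedTransportAtTwo
  Summit.BirchSwinnertonDyer.BirchSwinnertonDyer.Theorems.AlignedTransportAtTwoKilfordStratumShared
  Summit.BirchSwinnertonDyer.BirchSwinnertonDyer.Theorems.AlignedTransportAtTwoCubicCarrierRoad
  Summit.BirchSwinnertonDyer.BirchSwinnertonDyer.Theorems.AlignedTransportAtTwoCubicKilfordPrimes
  Summit.BirchSwinnertonDyer.BirchSwinnertonDyer.Theorems.AlignedTransportAtTwoCubicDepthDoorGenusCert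
  Summit.BirchSwinnertonDyer.BirchSwinnertonDyer.Theorems.AlignedTransportAtTwoCubicPrimesOfEmbeddings
  Summit.BirchSwinnertonDyer.BirchSwinnertonDyer.Theorems.AlignedTransportAtTwoCubicLayerOneDoors

variable (W : WeierstrassCurve ℚ) [W.IsElliptic] [W.IsGloballyMinimal]

/-! ## §1 `rank₂ ≤ 1`, `μ₂ = 0`, `λ₂ ≤ 1` for the cubic `2`-torsion field from `ε ≢ ±1 (mod 𝔭₁⁴)` and `4 ∣ h(ℚ(β,√2))` -/

/-- **THE PRO-CYCLIC DOOR FOR THE CUBIC `2`-TORSION FIELD.**  `W/ℚ` globally minimal, good ordinary at `2`, no rational `2`-torsion abscissa,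
`Δ_min ≡ 5 (mod 8)` (exactly two primes of `ℚ(β)` above `2`), `β ∈ ℚ̄` a root of the `2`-division cubic; displayed: `h(ℚ(β))` odd, `2 ∤ d_{ℚ(β)}`, an ideal `𝔭₁` of
norm `2`, a unit `ε` of `𝓞_{ℚ(β)}` with **`ε − 1 ∉ 𝔭₁⁴` and `ε + 1 ∉ 𝔭₁⁴`** (`2`-adic depth `≤ 3`, so `ε ∉ N_{K_2/K}K_2ˣ`), a cyclotomic `ℤ₂`-extension `κ` of `ℚ(β)` with
**`2 ≤ ord₂ h(K_1)`**.  THEN `rank₂ Cl(K_m) ≤ 1` for every `m`, `μ₂(κ) = 0` and `λ₂(κ) ≤ 1`. [cite: Washington1997, §13.3 Prop. 13.22–13.23]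
[cite: Lang1990, Ch. 13 §4, Lemma 4.1 (PDF pp. 203–204)] [cite: Fukuda1994, Thm. 1 (2), p. 264] [cite: NeukirchANT1999, Ch. V §1] -/
theorem classGroupPRank_le_one_adjoin_of_two_le_of_not_mem_pow_four (hord : IsOrdinaryAt W 2)
    (ht : ∀ x : ℚ, ¬ HasRationalTwoTorsionX W x) (h85 : minimalDiscriminantInt W % 8 = 5)
    {β : AlgebraicClosure ℚ} (hβ : aeval β W.twoTorsionPolynomial.toPoly = 0)
    (hh : haveI : FiniteDimensional ℚ ↥(IntermediateField.adjoin ℚ ({β} : Set (AlgebraicClosure ℚ))) :=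
        IntermediateField.adjoin.finiteDimensional ((AlgebraicClosure.isAlgebraic ℚ).isAlgebraic β).isIntegral
      haveI : NumberField ↥(IntermediateField.adjoin ℚ ({β} : Set (AlgebraicClosure ℚ))) := NumberField.mk
      ¬ 2 ∣ classNumber ↥(IntermediateField.adjoin ℚ ({β} : Set (AlgebraicClosure ℚ))))
    (hd : haveI : FiniteDimensional ℚ ↥(IntermediateField.adjoin ℚ ({β} : Set (AlgebraicClosure ℚ))) :=
        IntermediateField.adjoin.finiteDimensional ((AlgebraicClosure.isAlgebraic ℚ).isAlgebraic β).isIntegral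
      haveI : NumberField ↥(IntermediateField.adjoin ℚ ({β} : Set (AlgebraicClosure ℚ))) := NumberField.mk
      ¬ (2 : ℤ) ∣ NumberField.discr ↥(IntermediateField.adjoin ℚ ({β} : Set (AlgebraicClosure ℚ))))
    (𝔭₁ : Ideal (𝓞 ↥(IntermediateField.adjoin ℚ ({β} : Set (AlgebraicClosure ℚ)))))
    (hN : haveI : FiniteDimensional ℚ ↥(IntermediateField.adjoin ℚ ({β} : Set (AlgebraicClosure ℚ))) :=
        IntermediateField.adjoin.finiteDimensional ((AlgebraicClosure.isAlgebraic ℚ).isAlgebraic β).isIntegral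
      haveI : NumberField ↥(IntermediateField.adjoin ℚ ({β} : Set (AlgebraicClosure ℚ))) := NumberField.mk
      Ideal.absNorm 𝔭₁ = 2)
    (ε : (𝓞 ↥(IntermediateField.adjoin ℚ ({β} : Set (AlgebraicClosure ℚ))))ˣ)
    (hε1 : (ε : 𝓞 ↥(IntermediateField.adjoin ℚ ({β} : Set (AlgebraicClosure ℚ)))) - 1 ∉ 𝔭₁ ^ 4)
    (hε2 : (ε : 𝓞 ↥(IntermediateField.adjoin ℚ ({β} : Set (AlgebraicClosure ℚ)))) + 1 ∉ 𝔭₁ ^ 4)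
    (κP : ZpExtension ↥(IntermediateField.adjoin ℚ ({β} : Set (AlgebraicClosure ℚ))) 2) (hκP : κP.IsCyclotomic)
    (he1 : classNumberPExp κP 1 ≥ 2) :
    (∀ m, classGroupPRank κP m ≤ 1) ∧ ClassicalMuVanishes κP ∧ classicalLambda κP ≤ 1 := by
  have hirr := AlignedTransportAtTwoSeed.irr_two_of_forall_not_hasRationalTwoTorsionX W ht
  have hβint : IsIntegral ℚ β := ((AlgebraicClosure.isAlgebraic ℚ).isAlgebraic β).isIntegral
  haveI : FiniteDimensional ℚ ↥(IntermediateField.adjoin ℚ ({β} : Set (AlgebraicClosure ℚ))) := IntermediateField.adjoin.finiteDimensional hβint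
  haveI : NumberField ↥(IntermediateField.adjoin ℚ ({β} : Set (AlgebraicClosure ℚ))) := NumberField.mk
  haveI : Fact (Nat.Prime 2) := ⟨Nat.prime_two⟩
  haveI : FiniteDimensional ↥(IntermediateField.adjoin ℚ ({β} : Set (AlgebraicClosure ℚ))) (κP.layer 2) := κP.finiteDimensional_layer_holds 2
  haveI : NumberField (κP.layer 2) := NumberField.of_module_finite ↥(IntermediateField.adjoin ℚ ({β} : Set (AlgebraicClosure ℚ))) _
  have h3 : Module.finrank ℚ ↥(IntermediateField.adjoin ℚ ({β} : Set (AlgebraicClosure ℚ))) = 3 :=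
    AddKatoTwo.finrank_adjoin_root_twoTorsionPolynomial_eq_three W hirr hβ
  have hodd3 : ¬ 2 ∣ Module.finrank ℚ ↥(IntermediateField.adjoin ℚ ({β} : Set (AlgebraicClosure ℚ))) := by rw [h3]; decide
  have h8 : minimalDiscriminantInt W % 8 ≠ 1 := by rw [h85]; decide
  have hs := (not_onKilfordStratumAtTwo_iff_minimalDiscriminantInt_emod_eight_ne W hord).mpr h8
  have h2 := ncard_eq_two_of_not_onKilfordStratumAtTwo ↥(IntermediateField.adjoin ℚ ({β} : Set (AlgebraicClosure ℚ))) W hord ht h3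
    (AlignedTransportAtTwoCubicKilfordPrimes.aeval_four_mul_gen_twoDivisionUCubic W hβ) hs
  -- the dyadic prime `𝔭₁` of degree one
  obtain ⟨h𝔭₁, hP0, h2P, hcard⟩ := isPrime_and_mem_of_absNorm_eq_two 𝔭₁ hN
  haveI := h𝔭₁
  haveI : 𝔭₁.IsMaximal := h𝔭₁.isMaximal hP0
  have hres := forall_mem_or_sub_one_mem_of_card_quotient_eq_two 𝔭₁ hcard
  have h2P' : (2 : 𝓞 ↥(IntermediateField.adjoin ℚ ({β} : Set (AlgebraicClosure ℚ)))) ∉ 𝔭₁ ^ 2 := two_not_mem_sq_of_not_dvd_discr hd 𝔭₁ h2P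
  exact classGroupPRank_le_one_of_two_le_of_not_mem_pow_four_of_not_dvd_discr hodd3 hd κP hκP h2 hh he1 𝔭₁ hres h2P h2P' ε hε1 hε2

/-! ## §2 The door into `MC₂(W)` -/

/-- **THE PRO-CYCLIC DOOR INTO `MC₂(W)`.**  PRINT⁵ {Kato 17.4 (1)(2) at `2` (`h17`), Greenberg 4.1 (`hGr`), period unit (`hper`), modularity (`hmod`), GZK
(`hGZK`)} + MuIneqʳ (`hI`, the registered stub VERBATIM) + the cell hypotheses (good ordinary at `2`, no rational `2`-torsion abscissa, `Δ_W < 0`, `r_an = 0`,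
analytic `μ₂ = 0` on the even branch, `BSD₂(W)`) + `Δ_min ≡ 5 (mod 8)` + `β` a root of the `2`-division cubic + the displayed data of `ℚ(β)` (`h` odd, `2 ∤ d`,
`𝔭₁` of norm `2`, a unit `ε ≢ ±1 (mod 𝔭₁⁴)`, and `2 ≤ ord₂ h(K_1)` for every cyclotomic `ℤ₂`-extension) ⟹ `MC₂(W)` (att-p5 g24's cubic carrier road ∘ §1).
[cite: Kato2004Asterisque, Thm. 17.4 (1)(2) (p. 273)] [cite: GreenbergLNM1716, Thm. 4.1 (p. 102) and Conj. 1.11 (p. 58)]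
[cite: Iwasawa1973MuInvariants, Thm. 2 and Thm. 3] [cite: Washington1997, §13.3 Prop. 13.22–13.23] [cite: Lang1990, Ch. 13 §4, Lemma 4.1] -/
theorem mazurMainConjecture_two_of_muIneqRel_of_two_le_of_not_mem_pow_four
    (h17 : ∀ [NeZero (W.conductorNorm ℤ)] (f : CuspForm (Gamma0 (W.conductorNorm ℤ)) 2),
      kato_divisibility_allPrimes W 2 (f := f))
    (hGr : Greenberg1999.thm41_charValue_rankZero_anyPrime)
    (hper : realPeriodRat_eq_unit_mul_plusPeriod_two) (hmod : nonempty_modularParametrizationData)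
    (hGZK : rank_eq_analyticRank_of_analyticRank_le_one)
    (hI : ∀ (W : WeierstrassCurve ℚ) [W.IsElliptic] [W.IsGloballyMinimal], IsOrdinaryAt W 2 →
      (∀ x : ℚ, ¬ HasRationalTwoTorsionX W x) →
      ∀ (κ : ZpExtension ℚ 2) (γ : Field.absoluteGaloisGroup ℚ), κ.IsCyclotomic →
      κ.IsTopGenerator γ → IsCyclotomicVariable 2 γ →
      ∀ ⦃N : ℕ⦄ [NeZero N] (f : CuspForm (Gamma0 N) 2), IsNewformOf W f →
      ∀ Gp : IwasawaAlgebra 2, iwasawaToPowerSeries 2 Gp = padicLFunction f (unitRoot W 2 : ℚ_[2]) →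
      ∀ (D : W.SelmerDualData κ γ) (Yr : W.FineSelmerDualDataRelaxedInf κ γ),
        lengthAt (IwasawaAlgebra 2) D.X ⟨IwasawaAlgebra.augIdealP 2, IwasawaAlgebra.isPrime_augIdealP_holds 2⟩ ≤
          lengthAt (IwasawaAlgebra 2) (IwasawaAlgebra 2 ⧸ Ideal.span {Gp})
              ⟨IwasawaAlgebra.augIdealP 2, IwasawaAlgebra.isPrime_augIdealP_holds 2⟩ +
            lengthAt (IwasawaAlgebra 2) Yr.X ⟨IwasawaAlgebra.augIdealP 2, IwasawaAlgebra.isPrime_augIdealP_holds 2⟩)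
    (hord : IsOrdinaryAt W 2) (ht : ∀ x : ℚ, ¬ HasRationalTwoTorsionX W x) (hΔ : W.Δ < 0) (hr : W.analyticRank = 0)
    (hμan : ∀ ⦃N : ℕ⦄ [NeZero N] (f : CuspForm (Gamma0 N) 2), IsNewformOf W f →
      ∀ G : IwasawaAlgebra 2, IsEvenBranchLiftAtTwo W f G → red G ≠ 0)
    (hbsd : BSDp W 2) (h85 : minimalDiscriminantInt W % 8 = 5)
    {β : AlgebraicClosure ℚ} (hβ : aeval β W.twoTorsionPolynomial.toPoly = 0)
    (hh : haveI : FiniteDimensional ℚ ↥(IntermediateField.adjoin ℚ ({β} : Set (AlgebraicClosure ℚ))) :=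
        IntermediateField.adjoin.finiteDimensional ((AlgebraicClosure.isAlgebraic ℚ).isAlgebraic β).isIntegral
      haveI : NumberField ↥(IntermediateField.adjoin ℚ ({β} : Set (AlgebraicClosure ℚ))) := NumberField.mk
      ¬ 2 ∣ classNumber ↥(IntermediateField.adjoin ℚ ({β} : Set (AlgebraicClosure ℚ))))
    (hd : haveI : FiniteDimensional ℚ ↥(IntermediateField.adjoin ℚ ({β} : Set (AlgebraicClosure ℚ))) :=
        IntermediateField.adjoin.finiteDimensional ((AlgebraicClosure.isAlgebraic ℚ).isAlgebraic β).isIntegral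
      haveI : NumberField ↥(IntermediateField.adjoin ℚ ({β} : Set (AlgebraicClosure ℚ))) := NumberField.mk
      ¬ (2 : ℤ) ∣ NumberField.discr ↥(IntermediateField.adjoin ℚ ({β} : Set (AlgebraicClosure ℚ))))
    (𝔭₁ : Ideal (𝓞 ↥(IntermediateField.adjoin ℚ ({β} : Set (AlgebraicClosure ℚ)))))
    (hN : haveI : FiniteDimensional ℚ ↥(IntermediateField.adjoin ℚ ({β} : Set (AlgebraicClosure ℚ))) :=
        IntermediateField.adjoin.finiteDimensional ((AlgebraicClosure.isAlgebraic ℚ).isAlgebraic β).isIntegral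
      haveI : NumberField ↥(IntermediateField.adjoin ℚ ({β} : Set (AlgebraicClosure ℚ))) := NumberField.mk
      Ideal.absNorm 𝔭₁ = 2)
    (ε : (𝓞 ↥(IntermediateField.adjoin ℚ ({β} : Set (AlgebraicClosure ℚ))))ˣ)
    (hε1 : (ε : 𝓞 ↥(IntermediateField.adjoin ℚ ({β} : Set (AlgebraicClosure ℚ)))) - 1 ∉ 𝔭₁ ^ 4)
    (hε2 : (ε : 𝓞 ↥(IntermediateField.adjoin ℚ ({β} : Set (AlgebraicClosure ℚ)))) + 1 ∉ 𝔭₁ ^ 4)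
    (he1 : ∀ κP : ZpExtension ↥(IntermediateField.adjoin ℚ ({β} : Set (AlgebraicClosure ℚ))) 2, κP.IsCyclotomic → classNumberPExp κP 1 ≥ 2) :
    MazurMainConjecture W 2 :=
  mazurMainConjecture_two_of_muIneqRel_of_classicalMu_cubicField_of_Δ_neg W h17 hGr hper hmod hGZK hI hord ht hΔ hr hμan hbsd hβ
    fun κP hκP => (classGroupPRank_le_one_adjoin_of_two_le_of_not_mem_pow_four W hord ht h85 hβ hh hd 𝔭₁ hN ε hε1 hε2 κP hκP (he1 κP hκP)).2.1

end Summit.BirchSwinnertonDyer.BirchSwinnertonDyer.Theorems.AlignedTransportAtTwoCubicProCyclicDoor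

end
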